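import Summits.AnomalousDissipation.AnomalousDissipation.Theorems.TaylorCertificatesFloorCertificateStubMinimaxAlternativeTools

/-!
# Stub `stub_minimaxAlternative` (S3) of the line `dissipation-deficit-duality`
# (crux stmt-AnomalousDissipation-14091, `TaylorCertificates.FloorCertificate`)

THE MINIMAX ALTERNATIVE WITH SLOPE-BOUNDED MULTIPLIERS — strong duality in mean form on a
dissipation sublevel set, tail included —, given the sister stubs S0 (lower semicontinuity of the
mean enstrophy on `ProbabilityMeasure H`), S1 (compactness of the dissipation sublevel sets of
ball-carried probability measures), S2 (Ky Fan's convex-like minimax principle, Fan 1953 Thm 2)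
and S3a (linear combinations of cylindrical test functionals realised on a ball), all taken as
hypotheses.

At fixed `(f, ν)`, slope `L ≥ 0`, level `γ` and slack `η > 0`: EITHER some multiplier `(Φ, θ)`
with `−L ≤ θ ≤ 0` and `|⟨F(u),Φ'(u)⟩| ≤ L` on the Leray ball `{|u|² ≤ 16‖f‖²/ν²}` certifies the
floor `FloorIneq ν f Φ θ (γ − η)` at EVERY finite-enstrophy ball state, OR an
`(L, γ + η)`-approximately relaxed statistic exists (a probability measure carried by the ball,
of finite mean enstrophy, with integrable work and generators, mean dissipation `≤ γ + η`, and
penalised Lagrangian `≤ γ + η` against every slope-`L` multiplier).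

Proof (on top of `…StubMinimaxAlternativeTools`): the game `X = {μ : μ-a.e. |u|² ≤ ρ, ∫⁻‖∇u‖² ≤ C}`
(compact by S1) against `Y_L = {(Φ, θ) : −L ≤ θ ≤ 0, |⟨F,Φ'⟩| ≤ L on the ball}` with pay-off the
Lagrangian `ε(μ) + ∫⟨F,Φ'⟩dμ + 2θ(∫(u,f)dμ − ε(μ))`; `lagrangian_lowerSemicontinuous` (Tools), `fan_convex` (mixtures; the
Lagrangian is affine), `fan_concave` (S3a + linearity of the generator) are Fan's hypotheses;
`fan_game` applies S2; `alternative_on_sublevel` is the alternative at level `M`; the stub takes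
`ρ = 16‖f‖²/ν²`, `C = c/ν`, `c = L(1 + 2√ρ‖f‖) + |γ| + η + 1`, `M = γ + η`, and closes the first
horn by Dirac masses (`ν‖∇u‖² ≤ c`) and the tail estimate (`ν‖∇u‖² > c`). References: Ky Fan,
*Minimax theorems*, PNAS 39 (1953) 42–47, Thm 2; Foias–Manley–Rosa–Temam (2001), Ch. IV §1.2.
-/

noncomputable section

set_option linter.dupNamespace false

namespace Summit.AnomalousDissipation.AnomalousDissipation.Theorems.TaylorCertificatesFloorCertificate

open MeasureTheory Filter Topology UnitAddTorus
open scoped InnerProductSpace ENNReal NNReal BoundedContinuousFunction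
open Literature.Analysis.FunctionSpaces Literature.Analysis.FluidPDE
open Summit.AnomalousDissipation.AnomalousDissipation.Theorems.FloorCertificate.Negative

/-! ## Ky Fan's hypotheses (ii), (iii) and the game -/

/-- **Convex-likeness in the measure**: the mixture `t μ₁ + (1 − t) μ₂` of two probability
measures carried by the ball with mean enstrophy `≤ C` is again such a measure, and the
Lagrangian is AFFINE along it (hypothesis (ii) of Fan 1953, Thm 2). [folklore] -/
theorem fan_convex {ν : ℝ} {f : (UnitAddTorus (Fin 3) → EuclideanSpace ℝ (Fin 3))} (hf : MemLp f 2 volume) (ρ : ℝ) {C : ℝ≥0∞} (hC : C ≠ ⊤)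
    (μ₁ μ₂ : ProbabilityMeasure (Torus.energySpace (Fin 3)))
    (h₁ : (∀ᵐ u ∂(μ₁ : Measure (Torus.energySpace (Fin 3))), ‖u‖ ^ 2 ≤ ρ) ∧ Torus.ensembleEnstrophy (μ₁ : Measure (Torus.energySpace (Fin 3))) ≤ C)
    (h₂ : (∀ᵐ u ∂(μ₂ : Measure (Torus.energySpace (Fin 3))), ‖u‖ ^ 2 ≤ ρ) ∧ Torus.ensembleEnstrophy (μ₂ : Measure (Torus.energySpace (Fin 3))) ≤ C)
    {t : ℝ} (ht0 : 0 ≤ t) (ht1 : t ≤ 1) :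
    ∃ μ₀ : ProbabilityMeasure (Torus.energySpace (Fin 3)),
      ((∀ᵐ u ∂(μ₀ : Measure (Torus.energySpace (Fin 3))), ‖u‖ ^ 2 ≤ ρ) ∧ Torus.ensembleEnstrophy (μ₀ : Measure (Torus.energySpace (Fin 3))) ≤ C) ∧
      ∀ (Φ : Torus.CylindricalTest (Fin 3)) (θ : ℝ),
        Torus.ensembleDissipation ν (μ₀ : Measure (Torus.energySpace (Fin 3))) +
            ∫ u, Torus.nsGeneratorPairing ν f u (Φ.grad u) ∂(μ₀ : Measure (Torus.energySpace (Fin 3))) +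
            2 * θ * ((∫ u, Torus.pairing u.1 f ∂(μ₀ : Measure (Torus.energySpace (Fin 3)))) -
              Torus.ensembleDissipation ν (μ₀ : Measure (Torus.energySpace (Fin 3)))) =
          t * (Torus.ensembleDissipation ν (μ₁ : Measure (Torus.energySpace (Fin 3))) +
            ∫ u, Torus.nsGeneratorPairing ν f u (Φ.grad u) ∂(μ₁ : Measure (Torus.energySpace (Fin 3))) +
            2 * θ * ((∫ u, Torus.pairing u.1 f ∂(μ₁ : Measure (Torus.energySpace (Fin 3)))) -
              Torus.ensembleDissipation ν (μ₁ : Measure (Torus.energySpace (Fin 3))))) +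
          (1 - t) * (Torus.ensembleDissipation ν (μ₂ : Measure (Torus.energySpace (Fin 3))) +
            ∫ u, Torus.nsGeneratorPairing ν f u (Φ.grad u) ∂(μ₂ : Measure (Torus.energySpace (Fin 3))) +
            2 * θ * ((∫ u, Torus.pairing u.1 f ∂(μ₂ : Measure (Torus.energySpace (Fin 3)))) -
              Torus.ensembleDissipation ν (μ₂ : Measure (Torus.energySpace (Fin 3))))) := by
  set m : Measure (Torus.energySpace (Fin 3)) := ENNReal.ofReal t • (μ₁ : Measure (Torus.energySpace (Fin 3))) +
    ENNReal.ofReal (1 - t) • (μ₂ : Measure (Torus.energySpace (Fin 3))) with hm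
  have hprob : IsProbabilityMeasure m := isProbabilityMeasure_mix _ _ ht0 ht1
  have hae : ∀ᵐ u ∂m, ‖u‖ ^ 2 ≤ ρ := ae_mix _ _ h₁.1 h₂.1
  have hE : Torus.ensembleEnstrophy m = ENNReal.ofReal t * Torus.ensembleEnstrophy (μ₁ : Measure (Torus.energySpace (Fin 3))) +
      ENNReal.ofReal (1 - t) * Torus.ensembleEnstrophy (μ₂ : Measure (Torus.energySpace (Fin 3))) :=
    lintegral_mix _ _ _ _ _
  have hE₁ : Torus.ensembleEnstrophy (μ₁ : Measure (Torus.energySpace (Fin 3))) ≠ ⊤ := ne_top_of_le_ne_top hC h₁.2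
  have hE₂ : Torus.ensembleEnstrophy (μ₂ : Measure (Torus.energySpace (Fin 3))) ≠ ⊤ := ne_top_of_le_ne_top hC h₂.2
  refine ⟨⟨m, hprob⟩, ⟨hae, ?_⟩, fun Φ θ => ?_⟩
  · rw [ProbabilityMeasure.coe_mk, hE]
    exact mix_le ht0 ht1 h₁.2 h₂.2
  · obtain ⟨K, hK⟩ := abs_nsGeneratorPairing_grad_growth ν hf Φ
    have hcg := Torus.continuous_nsGeneratorPairing_grad ν (hf.integrable one_le_two) Φ
    have hG : ∫ u, Torus.nsGeneratorPairing ν f u (Φ.grad u) ∂m =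
        t * ∫ u, Torus.nsGeneratorPairing ν f u (Φ.grad u) ∂(μ₁ : Measure (Torus.energySpace (Fin 3))) +
          (1 - t) * ∫ u, Torus.nsGeneratorPairing ν f u (Φ.grad u) ∂(μ₂ : Measure (Torus.energySpace (Fin 3))) :=
      integral_mix _ _ ht0 ht1 (integrable_of_ball hcg hK _ h₁.1) (integrable_of_ball hcg hK _ h₂.1)
    have hW : ∫ u, Torus.pairing u.1 f ∂m =
        t * ∫ u, Torus.pairing u.1 f ∂(μ₁ : Measure (Torus.energySpace (Fin 3))) +
          (1 - t) * ∫ u, Torus.pairing u.1 f ∂(μ₂ : Measure (Torus.energySpace (Fin 3))) :=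
      integral_mix _ _ ht0 ht1
        (integrable_of_ball (Torus.continuous_pairing_coe hf) (abs_pairing_growth hf) _ h₁.1)
        (integrable_of_ball (Torus.continuous_pairing_coe hf) (abs_pairing_growth hf) _ h₂.1)
    simp only [ProbabilityMeasure.coe_mk, Torus.ensembleDissipation]
    rw [hE, toReal_mix ht0 ht1 hE₁ hE₂, hG, hW]
    ring

/-- **Concave-likeness in the multiplier**: for slope-`L` multipliers `(Φ₁, θ₁)`, `(Φ₂, θ₂)` and
`t ∈ [0,1]`, the cylindrical test functional `Φ₀` of S3a realising `tΦ₁' + (1−t)Φ₂'` on the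
ball, with `θ₀ = tθ₁ + (1−t)θ₂`, is a slope-`L` multiplier along which the Lagrangian of every
ball-carried finite measure is the convex combination (hypothesis (iii) of Fan 1953, Thm 2).
[folklore] -/
theorem fan_concave
    (hS3a : ∀ (ρ a b : ℝ) (Φ₁ Φ₂ : Torus.CylindricalTest (Fin 3)),
      ∃ Φ₀ : Torus.CylindricalTest (Fin 3),
        ∀ u : (Torus.energySpace (Fin 3)), ‖u‖ ^ 2 ≤ ρ → Φ₀.grad u = a • Φ₁.grad u + b • Φ₂.grad u)
    (ν : ℝ) {f : (UnitAddTorus (Fin 3) → EuclideanSpace ℝ (Fin 3))} (hf : MemLp f 2 volume) (ρ : ℝ) {L : ℝ}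
    {Φ₁ Φ₂ : Torus.CylindricalTest (Fin 3)} {θ₁ θ₂ : ℝ}
    (hy₁ : -L ≤ θ₁ ∧ θ₁ ≤ 0 ∧
      ∀ u : (Torus.energySpace (Fin 3)), ‖u‖ ^ 2 ≤ ρ → |Torus.nsGeneratorPairing ν f u (Φ₁.grad u)| ≤ L)
    (hy₂ : -L ≤ θ₂ ∧ θ₂ ≤ 0 ∧
      ∀ u : (Torus.energySpace (Fin 3)), ‖u‖ ^ 2 ≤ ρ → |Torus.nsGeneratorPairing ν f u (Φ₂.grad u)| ≤ L)
    {t : ℝ} (ht0 : 0 ≤ t) (ht1 : t ≤ 1) :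
    ∃ (Φ₀ : Torus.CylindricalTest (Fin 3)) (θ₀ : ℝ),
      (-L ≤ θ₀ ∧ θ₀ ≤ 0 ∧
        ∀ u : (Torus.energySpace (Fin 3)), ‖u‖ ^ 2 ≤ ρ → |Torus.nsGeneratorPairing ν f u (Φ₀.grad u)| ≤ L) ∧
      ∀ μ : Measure (Torus.energySpace (Fin 3)), IsFiniteMeasure μ → (∀ᵐ u ∂μ, ‖u‖ ^ 2 ≤ ρ) →
        Torus.ensembleDissipation ν μ + ∫ u, Torus.nsGeneratorPairing ν f u (Φ₀.grad u) ∂μ +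
            2 * θ₀ * ((∫ u, Torus.pairing u.1 f ∂μ) - Torus.ensembleDissipation ν μ) =
          t * (Torus.ensembleDissipation ν μ + ∫ u, Torus.nsGeneratorPairing ν f u (Φ₁.grad u) ∂μ +
            2 * θ₁ * ((∫ u, Torus.pairing u.1 f ∂μ) - Torus.ensembleDissipation ν μ)) +
          (1 - t) * (Torus.ensembleDissipation ν μ +
            ∫ u, Torus.nsGeneratorPairing ν f u (Φ₂.grad u) ∂μ +
            2 * θ₂ * ((∫ u, Torus.pairing u.1 f ∂μ) - Torus.ensembleDissipation ν μ)) := by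
  obtain ⟨Φ₀, hΦ₀⟩ := hS3a ρ t (1 - t) Φ₁ Φ₂
  have hf1 : Integrable f volume := hf.integrable one_le_two
  have hpt : ∀ u : (Torus.energySpace (Fin 3)), ‖u‖ ^ 2 ≤ ρ → Torus.nsGeneratorPairing ν f u (Φ₀.grad u) =
      t * Torus.nsGeneratorPairing ν f u (Φ₁.grad u) +
        (1 - t) * Torus.nsGeneratorPairing ν f u (Φ₂.grad u) := fun u hu =>
    nsGeneratorPairing_of_grad_eq ν hf1 u t (1 - t) (hΦ₀ u hu)
  obtain ⟨hL₁, h0₁, hs₁⟩ := hy₁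
  obtain ⟨hL₂, h0₂, hs₂⟩ := hy₂
  have ht1' : 0 ≤ 1 - t := by linarith
  refine ⟨Φ₀, t * θ₁ + (1 - t) * θ₂, ⟨?_, ?_, fun u hu => ?_⟩, fun μ hμ hball => ?_⟩
  · nlinarith [mul_nonneg ht0 (by linarith : 0 ≤ θ₁ + L), mul_nonneg ht1' (by linarith : 0 ≤ θ₂ + L)]
  · nlinarith [mul_nonneg ht0 (by linarith : 0 ≤ -θ₁), mul_nonneg ht1' (by linarith : 0 ≤ -θ₂)]
  · rw [hpt u hu]
    have e1 := hs₁ u hu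
    have e2 := hs₂ u hu
    calc |t * Torus.nsGeneratorPairing ν f u (Φ₁.grad u) +
            (1 - t) * Torus.nsGeneratorPairing ν f u (Φ₂.grad u)|
        ≤ |t * Torus.nsGeneratorPairing ν f u (Φ₁.grad u)| +
            |(1 - t) * Torus.nsGeneratorPairing ν f u (Φ₂.grad u)| := abs_add_le _ _
      _ = t * |Torus.nsGeneratorPairing ν f u (Φ₁.grad u)| +
            (1 - t) * |Torus.nsGeneratorPairing ν f u (Φ₂.grad u)| := by
          rw [abs_mul, abs_mul, abs_of_nonneg ht0, abs_of_nonneg ht1']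
      _ ≤ t * L + (1 - t) * L :=
          add_le_add (mul_le_mul_of_nonneg_left e1 ht0) (mul_le_mul_of_nonneg_left e2 ht1')
      _ = L := by ring
  · haveI := hμ
    obtain ⟨K₁, hK₁⟩ := abs_nsGeneratorPairing_grad_growth ν hf Φ₁
    obtain ⟨K₂, hK₂⟩ := abs_nsGeneratorPairing_grad_growth ν hf Φ₂
    have hi₁ := integrable_of_ball (Torus.continuous_nsGeneratorPairing_grad ν hf1 Φ₁) hK₁ μ hball
    have hi₂ := integrable_of_ball (Torus.continuous_nsGeneratorPairing_grad ν hf1 Φ₂) hK₂ μ hball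
    have hG : ∫ u, Torus.nsGeneratorPairing ν f u (Φ₀.grad u) ∂μ =
        t * ∫ u, Torus.nsGeneratorPairing ν f u (Φ₁.grad u) ∂μ +
          (1 - t) * ∫ u, Torus.nsGeneratorPairing ν f u (Φ₂.grad u) ∂μ := by
      rw [← integral_const_mul, ← integral_const_mul,
        ← integral_add (hi₁.const_mul t) (hi₂.const_mul (1 - t))]
      refine integral_congr_ae ?_
      filter_upwards [hball] with u hu
      exact hpt u hu
    rw [hG]
    ring

/-- **Ky Fan's theorem applied to the Lagrangian game** on the dissipation sublevel set
`X = {μ : μ-a.e. |u|² ≤ ρ, ∫⁻‖∇u‖² ≤ C}` (compact, S1) against the slope-`L` multipliers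
`Y_L` (nonempty: the flat test): if every `μ ∈ X` is beaten above `M` by some multiplier, ONE
multiplier beats all of `X` above `M` (Ky Fan, PNAS 39 (1953) 42–47, Thm 2, supplied as hypothesis S2).
[folklore] -/
theorem fan_game
    (hS0 : LowerSemicontinuous fun μ : ProbabilityMeasure (Torus.energySpace (Fin 3)) =>
      Torus.ensembleEnstrophy (μ : Measure (Torus.energySpace (Fin 3))))
    (hS2 : ∀ (X Y : Type) [TopologicalSpace X] [CompactSpace X] [Nonempty Y] (φ : X → Y → ℝ),
      (∀ y : Y, LowerSemicontinuous fun x : X => φ x y) →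
      (∀ (x₁ x₂ : X) (t : ℝ), 0 ≤ t → t ≤ 1 → ∃ x₀ : X, ∀ y : Y, φ x₀ y ≤ t * φ x₁ y + (1 - t) * φ x₂ y) →
      (∀ (y₁ y₂ : Y) (t : ℝ), 0 ≤ t → t ≤ 1 → ∃ y₀ : Y, ∀ x : X, t * φ x y₁ + (1 - t) * φ x y₂ ≤ φ x y₀) →
      ∀ γ : ℝ, (∀ x : X, ∃ y : Y, γ < φ x y) → ∃ y : Y, ∀ x : X, γ < φ x y)
    (hS3a : ∀ (ρ a b : ℝ) (Φ₁ Φ₂ : Torus.CylindricalTest (Fin 3)),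
      ∃ Φ₀ : Torus.CylindricalTest (Fin 3),
        ∀ u : (Torus.energySpace (Fin 3)), ‖u‖ ^ 2 ≤ ρ → Φ₀.grad u = a • Φ₁.grad u + b • Φ₂.grad u)
    {ν : ℝ} (hν : 0 < ν) {f : (UnitAddTorus (Fin 3) → EuclideanSpace ℝ (Fin 3))} (hf : MemLp f 2 volume) {L : ℝ} (hL : 0 ≤ L) (ρ M : ℝ)
    {C : ℝ≥0∞} (hC : C ≠ ⊤)
    (hcpt : IsCompact {μ : ProbabilityMeasure (Torus.energySpace (Fin 3)) |
        (∀ᵐ u ∂(μ : Measure (Torus.energySpace (Fin 3))), ‖u‖ ^ 2 ≤ ρ) ∧ Torus.ensembleEnstrophy (μ : Measure (Torus.energySpace (Fin 3))) ≤ C})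
    (hpt : ∀ μ : ProbabilityMeasure (Torus.energySpace (Fin 3)),
      μ ∈ {μ : ProbabilityMeasure (Torus.energySpace (Fin 3)) |
        (∀ᵐ u ∂(μ : Measure (Torus.energySpace (Fin 3))), ‖u‖ ^ 2 ≤ ρ) ∧ Torus.ensembleEnstrophy (μ : Measure (Torus.energySpace (Fin 3))) ≤ C} →
      ∃ (Φ : Torus.CylindricalTest (Fin 3)) (θ : ℝ),
        (-L ≤ θ ∧ θ ≤ 0 ∧
          ∀ u : (Torus.energySpace (Fin 3)), ‖u‖ ^ 2 ≤ ρ → |Torus.nsGeneratorPairing ν f u (Φ.grad u)| ≤ L) ∧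
        M < Torus.ensembleDissipation ν (μ : Measure (Torus.energySpace (Fin 3))) +
          ∫ u, Torus.nsGeneratorPairing ν f u (Φ.grad u) ∂(μ : Measure (Torus.energySpace (Fin 3))) +
          2 * θ * ((∫ u, Torus.pairing u.1 f ∂(μ : Measure (Torus.energySpace (Fin 3)))) -
            Torus.ensembleDissipation ν (μ : Measure (Torus.energySpace (Fin 3))))) :
    ∃ (Φ : Torus.CylindricalTest (Fin 3)) (θ : ℝ),
      (-L ≤ θ ∧ θ ≤ 0 ∧
        ∀ u : (Torus.energySpace (Fin 3)), ‖u‖ ^ 2 ≤ ρ → |Torus.nsGeneratorPairing ν f u (Φ.grad u)| ≤ L) ∧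
      ∀ μ : ProbabilityMeasure (Torus.energySpace (Fin 3)),
        μ ∈ {μ : ProbabilityMeasure (Torus.energySpace (Fin 3)) |
          (∀ᵐ u ∂(μ : Measure (Torus.energySpace (Fin 3))), ‖u‖ ^ 2 ≤ ρ) ∧ Torus.ensembleEnstrophy (μ : Measure (Torus.energySpace (Fin 3))) ≤ C} →
        M < Torus.ensembleDissipation ν (μ : Measure (Torus.energySpace (Fin 3))) +
          ∫ u, Torus.nsGeneratorPairing ν f u (Φ.grad u) ∂(μ : Measure (Torus.energySpace (Fin 3))) +
          2 * θ * ((∫ u, Torus.pairing u.1 f ∂(μ : Measure (Torus.energySpace (Fin 3)))) -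
            Torus.ensembleDissipation ν (μ : Measure (Torus.energySpace (Fin 3)))) := by
  haveI : CompactSpace {μ : ProbabilityMeasure (Torus.energySpace (Fin 3)) |
      (∀ᵐ u ∂(μ : Measure (Torus.energySpace (Fin 3))), ‖u‖ ^ 2 ≤ ρ) ∧ Torus.ensembleEnstrophy (μ : Measure (Torus.energySpace (Fin 3))) ≤ C} :=
    isCompact_iff_compactSpace.1 hcpt
  -- the multipliers `Y_L` are nonempty: the flat test with `θ = 0`
  obtain ⟨Φz, hΦz⟩ := exists_flat_test
  have hz : ∀ u : (Torus.energySpace (Fin 3)), Torus.nsGeneratorPairing ν f u (Φz.grad u) = 0 :=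
    hΦz ν f (hf.integrable one_le_two)
  haveI : Nonempty {p : Torus.CylindricalTest (Fin 3) × ℝ // -L ≤ p.2 ∧ p.2 ≤ 0 ∧
      ∀ u : (Torus.energySpace (Fin 3)), ‖u‖ ^ 2 ≤ ρ → |Torus.nsGeneratorPairing ν f u (p.1.grad u)| ≤ L} :=
    ⟨⟨(Φz, 0), by linarith, le_rfl, fun u _ => by rw [hz u, abs_zero]; exact hL⟩⟩
  -- Ky Fan
  obtain ⟨y₀, hy₀⟩ := hS2 _ _
    (fun (x : {μ : ProbabilityMeasure (Torus.energySpace (Fin 3)) |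
        (∀ᵐ u ∂(μ : Measure (Torus.energySpace (Fin 3))), ‖u‖ ^ 2 ≤ ρ) ∧ Torus.ensembleEnstrophy (μ : Measure (Torus.energySpace (Fin 3))) ≤ C})
      (y : {p : Torus.CylindricalTest (Fin 3) × ℝ // -L ≤ p.2 ∧ p.2 ≤ 0 ∧
        ∀ u : (Torus.energySpace (Fin 3)), ‖u‖ ^ 2 ≤ ρ → |Torus.nsGeneratorPairing ν f u (p.1.grad u)| ≤ L}) =>
      Torus.ensembleDissipation ν ((x : ProbabilityMeasure (Torus.energySpace (Fin 3))) : Measure (Torus.energySpace (Fin 3))) +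
        ∫ u, Torus.nsGeneratorPairing ν f u (y.1.1.grad u) ∂((x : ProbabilityMeasure (Torus.energySpace (Fin 3))) : Measure (Torus.energySpace (Fin 3))) +
        2 * y.1.2 * ((∫ u, Torus.pairing u.1 f ∂((x : ProbabilityMeasure (Torus.energySpace (Fin 3))) : Measure (Torus.energySpace (Fin 3)))) -
          Torus.ensembleDissipation ν ((x : ProbabilityMeasure (Torus.energySpace (Fin 3))) : Measure (Torus.energySpace (Fin 3)))))
    (fun y => lagrangian_lowerSemicontinuous hS0 hν hf ρ hC y.1.1 y.2.2.1)
    (fun x₁ x₂ t ht0 ht1 => by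
      obtain ⟨μ₀, hμ₀, hLag⟩ := fan_convex (ν := ν) hf ρ hC x₁.1 x₂.1 x₁.2 x₂.2 ht0 ht1
      exact ⟨⟨μ₀, hμ₀⟩, fun y => (hLag y.1.1 y.1.2).le⟩)
    (fun y₁ y₂ t ht0 ht1 => by
      obtain ⟨Φ₀, θ₀, hy, hLag⟩ := fan_concave hS3a ν hf ρ y₁.2 y₂.2 ht0 ht1
      exact ⟨⟨(Φ₀, θ₀), hy⟩, fun x => (hLag _ inferInstance x.2.1).ge⟩)
    M
    (fun x => by
      obtain ⟨Φ, θ, hy, hlt⟩ := hpt x.1 x.2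
      exact ⟨⟨(Φ, θ), hy⟩, hlt⟩)
  exact ⟨y₀.1.1, y₀.1.2, y₀.2, fun μ hμ => hy₀ ⟨μ, hμ⟩⟩

/-- **The minimax alternative on a dissipation sublevel set** (strong duality in mean form):
EITHER one slope-`L` multiplier makes the Lagrangian `> M` at every probability measure carried
by the ball `{|u|² ≤ ρ}` with mean enstrophy `≤ C`, OR some such measure is
`(L, M)`-approximately relaxed (mean dissipation `≤ M` and Lagrangian `≤ M` against every
slope-`L` multiplier). The flat multiplier turns `ε(μ) > M` into a beating multiplier; then
`fan_game`. [folklore] -/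
theorem alternative_on_sublevel
    (hS0 : LowerSemicontinuous fun μ : ProbabilityMeasure (Torus.energySpace (Fin 3)) =>
      Torus.ensembleEnstrophy (μ : Measure (Torus.energySpace (Fin 3))))
    (hS2 : ∀ (X Y : Type) [TopologicalSpace X] [CompactSpace X] [Nonempty Y] (φ : X → Y → ℝ),
      (∀ y : Y, LowerSemicontinuous fun x : X => φ x y) →
      (∀ (x₁ x₂ : X) (t : ℝ), 0 ≤ t → t ≤ 1 → ∃ x₀ : X, ∀ y : Y, φ x₀ y ≤ t * φ x₁ y + (1 - t) * φ x₂ y) →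
      (∀ (y₁ y₂ : Y) (t : ℝ), 0 ≤ t → t ≤ 1 → ∃ y₀ : Y, ∀ x : X, t * φ x y₁ + (1 - t) * φ x y₂ ≤ φ x y₀) →
      ∀ γ : ℝ, (∀ x : X, ∃ y : Y, γ < φ x y) → ∃ y : Y, ∀ x : X, γ < φ x y)
    (hS3a : ∀ (ρ a b : ℝ) (Φ₁ Φ₂ : Torus.CylindricalTest (Fin 3)),
      ∃ Φ₀ : Torus.CylindricalTest (Fin 3),
        ∀ u : (Torus.energySpace (Fin 3)), ‖u‖ ^ 2 ≤ ρ → Φ₀.grad u = a • Φ₁.grad u + b • Φ₂.grad u)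
    {ν : ℝ} (hν : 0 < ν) {f : (UnitAddTorus (Fin 3) → EuclideanSpace ℝ (Fin 3))} (hf : MemLp f 2 volume) {L : ℝ} (hL : 0 ≤ L) (ρ M : ℝ)
    {C : ℝ≥0∞} (hC : C ≠ ⊤)
    (hcpt : IsCompact {μ : ProbabilityMeasure (Torus.energySpace (Fin 3)) |
        (∀ᵐ u ∂(μ : Measure (Torus.energySpace (Fin 3))), ‖u‖ ^ 2 ≤ ρ) ∧ Torus.ensembleEnstrophy (μ : Measure (Torus.energySpace (Fin 3))) ≤ C}) :
    (∃ (Φ : Torus.CylindricalTest (Fin 3)) (θ : ℝ), -L ≤ θ ∧ θ ≤ 0 ∧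
        (∀ u : (Torus.energySpace (Fin 3)), ‖u‖ ^ 2 ≤ ρ → |Torus.nsGeneratorPairing ν f u (Φ.grad u)| ≤ L) ∧
        ∀ μ : Measure (Torus.energySpace (Fin 3)), IsProbabilityMeasure μ → (∀ᵐ u ∂μ, ‖u‖ ^ 2 ≤ ρ) →
          Torus.ensembleEnstrophy μ ≤ C →
          M < Torus.ensembleDissipation ν μ + ∫ u, Torus.nsGeneratorPairing ν f u (Φ.grad u) ∂μ +
            2 * θ * ((∫ u, Torus.pairing u.1 f ∂μ) - Torus.ensembleDissipation ν μ)) ∨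
      ∃ μ : Measure (Torus.energySpace (Fin 3)), IsProbabilityMeasure μ ∧ (∀ᵐ u ∂μ, ‖u‖ ^ 2 ≤ ρ) ∧
        Torus.ensembleEnstrophy μ < ⊤ ∧
        Integrable (fun u : (Torus.energySpace (Fin 3)) => Torus.pairing u.1 f) μ ∧
        (∀ Φ : Torus.CylindricalTest (Fin 3),
          Integrable (fun u => Torus.nsGeneratorPairing ν f u (Φ.grad u)) μ) ∧
        Torus.ensembleDissipation ν μ ≤ M ∧
        ∀ (Φ : Torus.CylindricalTest (Fin 3)) (θ : ℝ), -L ≤ θ → θ ≤ 0 →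
          (∀ u : (Torus.energySpace (Fin 3)), ‖u‖ ^ 2 ≤ ρ → |Torus.nsGeneratorPairing ν f u (Φ.grad u)| ≤ L) →
          Torus.ensembleDissipation ν μ + ∫ u, Torus.nsGeneratorPairing ν f u (Φ.grad u) ∂μ +
              2 * θ * ((∫ u, Torus.pairing u.1 f ∂μ) - Torus.ensembleDissipation ν μ) ≤ M := by
  rw [or_iff_not_imp_right]
  intro hno
  obtain ⟨Φz, hΦz⟩ := exists_flat_test
  have hf1 : Integrable f volume := hf.integrable one_le_two
  have hz : ∀ u : (Torus.energySpace (Fin 3)), Torus.nsGeneratorPairing ν f u (Φz.grad u) = 0 := hΦz ν f hf1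
  -- every `μ ∈ X` is beaten above `M`
  have hpt : ∀ μ : ProbabilityMeasure (Torus.energySpace (Fin 3)),
      μ ∈ {μ : ProbabilityMeasure (Torus.energySpace (Fin 3)) |
        (∀ᵐ u ∂(μ : Measure (Torus.energySpace (Fin 3))), ‖u‖ ^ 2 ≤ ρ) ∧ Torus.ensembleEnstrophy (μ : Measure (Torus.energySpace (Fin 3))) ≤ C} →
      ∃ (Φ : Torus.CylindricalTest (Fin 3)) (θ : ℝ),
        (-L ≤ θ ∧ θ ≤ 0 ∧
          ∀ u : (Torus.energySpace (Fin 3)), ‖u‖ ^ 2 ≤ ρ → |Torus.nsGeneratorPairing ν f u (Φ.grad u)| ≤ L) ∧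
        M < Torus.ensembleDissipation ν (μ : Measure (Torus.energySpace (Fin 3))) +
          ∫ u, Torus.nsGeneratorPairing ν f u (Φ.grad u) ∂(μ : Measure (Torus.energySpace (Fin 3))) +
          2 * θ * ((∫ u, Torus.pairing u.1 f ∂(μ : Measure (Torus.energySpace (Fin 3)))) -
            Torus.ensembleDissipation ν (μ : Measure (Torus.energySpace (Fin 3)))) := by
    intro μ hμ
    by_contra hcon
    push Not at hcon
    have hiw : Integrable (fun u : (Torus.energySpace (Fin 3)) => Torus.pairing u.1 f) (μ : Measure (Torus.energySpace (Fin 3))) :=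
      integrable_of_ball (Torus.continuous_pairing_coe hf) (abs_pairing_growth hf) _ hμ.1
    have hig : ∀ Φ : Torus.CylindricalTest (Fin 3),
        Integrable (fun u => Torus.nsGeneratorPairing ν f u (Φ.grad u)) (μ : Measure (Torus.energySpace (Fin 3))) := by
      intro Φ
      obtain ⟨K, hK⟩ := abs_nsGeneratorPairing_grad_growth ν hf Φ
      exact integrable_of_ball (Torus.continuous_nsGeneratorPairing_grad ν hf1 Φ) hK _ hμ.1
    have hD : Torus.ensembleDissipation ν (μ : Measure (Torus.energySpace (Fin 3))) ≤ M := by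
      have h := hcon Φz 0 ⟨by linarith, le_rfl, fun u _ => by rw [hz u, abs_zero]; exact hL⟩
      simpa [hz] using h
    exact hno ⟨(μ : Measure (Torus.energySpace (Fin 3))), inferInstance, hμ.1, lt_of_le_of_lt hμ.2 hC.lt_top, hiw, hig, hD,
      fun Φ θ h1 h2 h3 => hcon Φ θ ⟨h1, h2, h3⟩⟩
  obtain ⟨Φ, θ, ⟨hθL, hθ0, hslope⟩, hbeat⟩ :=
    fan_game hS0 hS2 hS3a hν hf hL ρ M hC hcpt hpt
  exact ⟨Φ, θ, hθL, hθ0, hslope, fun μ hμ hball hE => hbeat ⟨μ, hμ⟩ ⟨hball, hE⟩⟩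

/-! ## The stub -/

/-- **S3 `stub_minimaxAlternative`** — THE MINIMAX ALTERNATIVE WITH SLOPE-BOUNDED MULTIPLIERS
(strong duality in mean form on a dissipation sublevel set, tail included), GIVEN S0 (lsc of the
mean enstrophy), S1 (compact dissipation sublevel sets), S2 (Ky Fan's convex-like minimax
principle) and S3a (linear combinations of cylindrical tests realised on a ball). For `ν > 0`,
smooth `f`, slope `L ≥ 0`, level `γ`, slack `η > 0`: EITHER some multiplier `(Φ, θ)` with
`−L ≤ θ ≤ 0` and `|⟨F(u),Φ'(u)⟩| ≤ L` on the Leray ball certifies `FloorIneq ν f Φ θ (γ − η)` at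
EVERY state, OR an `(L, γ+η)`-approximately relaxed statistic exists. Proof: with
`ρ = 16‖f‖²/ν²`, `F = ‖f‖_{L²}`, `c = L(1 + 2√ρF) + |γ| + η + 1`, run
`alternative_on_sublevel` on `X = {μ : |u|² ≤ ρ a.e., ∫⁻‖∇u‖² ≤ c/ν}` at level `M = γ + η`;
its second horn is the second disjunct verbatim; its first horn gives a slope-`L` multiplier
beating `X` above `γ + η`, whence the floor `γ − η` at every finite-enstrophy ball state:
Dirac masses `δ_u ∈ X` when `ν‖∇u‖² ≤ c` (`lagrangian_dirac`), and the tail `ν‖∇u‖² > c`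
pays by itself (`tail_estimate`). [folklore] -/
theorem stub_minimaxAlternative :
    (LowerSemicontinuous fun μ : ProbabilityMeasure (Torus.energySpace (Fin 3)) =>
      Torus.ensembleEnstrophy (μ : Measure (Torus.energySpace (Fin 3)))) →
    (∀ (ρ : ℝ) (c : ℝ≥0∞), c ≠ ⊤ →
      IsCompact {μ : ProbabilityMeasure (Torus.energySpace (Fin 3)) |
        (∀ᵐ u ∂(μ : Measure (Torus.energySpace (Fin 3))), ‖u‖ ^ 2 ≤ ρ) ∧
          Torus.ensembleEnstrophy (μ : Measure (Torus.energySpace (Fin 3))) ≤ c}) →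
    (∀ (X Y : Type) [TopologicalSpace X] [CompactSpace X] [Nonempty Y] (φ : X → Y → ℝ),
      (∀ y : Y, LowerSemicontinuous fun x : X => φ x y) →
      (∀ (x₁ x₂ : X) (t : ℝ), 0 ≤ t → t ≤ 1 → ∃ x₀ : X, ∀ y : Y, φ x₀ y ≤ t * φ x₁ y + (1 - t) * φ x₂ y) →
      (∀ (y₁ y₂ : Y) (t : ℝ), 0 ≤ t → t ≤ 1 → ∃ y₀ : Y, ∀ x : X, t * φ x y₁ + (1 - t) * φ x y₂ ≤ φ x y₀) →
      ∀ γ : ℝ, (∀ x : X, ∃ y : Y, γ < φ x y) → ∃ y : Y, ∀ x : X, γ < φ x y) →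
    (∀ (ρ a b : ℝ) (Φ₁ Φ₂ : Torus.CylindricalTest (Fin 3)), ∃ Φ₀ : Torus.CylindricalTest (Fin 3),
      ∀ u : Torus.energySpace (Fin 3), ‖u‖ ^ 2 ≤ ρ → Φ₀.grad u = a • Φ₁.grad u + b • Φ₂.grad u) →
    ∀ (ν : ℝ) (f : UnitAddTorus (Fin 3) → EuclideanSpace ℝ (Fin 3)), 0 < ν → Torus.IsSmooth f →
    ∀ (L γ η : ℝ), 0 ≤ L → 0 < η →
      (∃ (Φ : Torus.CylindricalTest (Fin 3)) (θ : ℝ), -L ≤ θ ∧ θ ≤ 0 ∧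
          (∀ u : Torus.energySpace (Fin 3), ‖u‖ ^ 2 ≤ 16 * (∫ x, ‖f x‖ ^ 2) / ν ^ 2 →
            |Torus.nsGeneratorPairing ν f u (Φ.grad u)| ≤ L) ∧
          ∀ u : Torus.energySpace (Fin 3), FloorIneq ν f Φ θ (γ - η) u) ∨
        ∃ μ : Measure (Torus.energySpace (Fin 3)),
          IsProbabilityMeasure μ ∧
          (∀ᵐ u ∂μ, ‖u‖ ^ 2 ≤ 16 * (∫ x, ‖f x‖ ^ 2) / ν ^ 2) ∧
          Torus.ensembleEnstrophy μ < ⊤ ∧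
          Integrable (fun u : Torus.energySpace (Fin 3) => Torus.pairing u.1 f) μ ∧
          (∀ Φ : Torus.CylindricalTest (Fin 3),
            Integrable (fun u => Torus.nsGeneratorPairing ν f u (Φ.grad u)) μ) ∧
          Torus.ensembleDissipation ν μ ≤ γ + η ∧
          ∀ (Φ : Torus.CylindricalTest (Fin 3)) (θ : ℝ), -L ≤ θ → θ ≤ 0 →
            (∀ u : Torus.energySpace (Fin 3), ‖u‖ ^ 2 ≤ 16 * (∫ x, ‖f x‖ ^ 2) / ν ^ 2 →
              |Torus.nsGeneratorPairing ν f u (Φ.grad u)| ≤ L) →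
            Torus.ensembleDissipation ν μ + ∫ u, Torus.nsGeneratorPairing ν f u (Φ.grad u) ∂μ +
                2 * θ * ((∫ u, Torus.pairing u.1 f ∂μ) - Torus.ensembleDissipation ν μ) ≤ γ + η := by
  intro hS0 hS1 hS2 hS3a ν f hν hfs L γ η hL hη
  have hf : MemLp f 2 volume := hfs.memLp 2
  -- the constant `c = L(1 + 2√ρ‖f‖) + |γ| + η + 1 > 0` splitting Diracs from the tail
  obtain ⟨c, hc0, hcle⟩ : ∃ c : ℝ, 0 < c ∧
      L * (1 + 2 * (Real.sqrt (16 * (∫ x, ‖f x‖ ^ 2) / ν ^ 2) * ‖hf.toLp f‖)) + |γ| + η + 1 ≤ c := by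
    refine ⟨_, ?_, le_rfl⟩
    have h1 : 0 ≤ L * (1 + 2 * (Real.sqrt (16 * (∫ x, ‖f x‖ ^ 2) / ν ^ 2) * ‖hf.toLp f‖)) := by
      positivity
    have h2 := abs_nonneg γ
    linarith
  have hC : ENNReal.ofReal (c / ν) ≠ ⊤ := ENNReal.ofReal_ne_top
  rcases alternative_on_sublevel hS0 hS2 hS3a hν hf hL (16 * (∫ x, ‖f x‖ ^ 2) / ν ^ 2) (γ + η) hC
      (hS1 _ _ hC) with ⟨Φ, θ, hθL, hθ0, hslope, hbeat⟩ | hright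
  · refine Or.inl ⟨Φ, θ, hθL, hθ0, hslope, fun u hfin hball => ?_⟩
    rcases le_or_gt (ν * (Torus.eGradNormSq (u.1 : UnitAddTorus (Fin 3) → EuclideanSpace ℝ (Fin 3))).toReal) c with hle | hlt
    · -- the Dirac mass `δ_u` lies in `X`: the multiplier beats it above `γ + η`
      have hE : Torus.ensembleEnstrophy (Measure.dirac u) ≤ ENNReal.ofReal (c / ν) := by
        rw [ensembleEnstrophy_dirac, ← ENNReal.ofReal_toReal hfin]
        refine ENNReal.ofReal_le_ofReal ?_
        rw [le_div_iff₀ hν, mul_comm]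
        exact hle
      have h := hbeat (Measure.dirac u) inferInstance (ae_dirac_of hball) hE
      rw [lagrangian_dirac] at h
      linarith
    · -- the tail `ν‖∇u‖² > c` pays by itself
      exact tail_estimate hL hη.le hθL hθ0 (hslope u hball) (abs_pairing_le_of_ball hf hball)
        (by positivity) hlt hcle
  · exact Or.inr hright

end Summit.AnomalousDissipation.AnomalousDissipation.Theorems.TaylorCertificatesFloorCertificate

end
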